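import Mathlib
import Literature.NumberTheory.GaloisRepresentations.NearlyOrdinaryPresentation
import Literature.NumberTheory.GaloisRepresentations.PotentialDiagonalizabilityCriteriaProofs
import Literature.RingTheory.MvPowerSeries.OptionEquivLeft
import Literature.AlgebraicGeometry.Resolution.FormalNormalCrossingsLemmas
import Literature.AlgebraicGeometry.Resolution.AdicNoetherian
import Literature.RingTheory.RegularLocalRing.SopRegular
import Literature.RingTheory.CompleteLocalRings.CotangentPresentation
import Literature.RingTheory.CompleteLocalRings.RelationCount
import Literature.RingTheory.CompleteLocalRings.DualNumberPointsRelative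
import Literature.NumberTheory.GaloisRepresentations.NearlyOrdinaryTangentSpace
import HarnessLib

/-!
# Böckle's presentation of the nearly ordinary deformation ring — the commutative algebra of
`𝒪⟦T₁, …, T_n⟧` and the assembly step (proofs)

Topic `Literature/NumberTheory/GaloisRepresentations`.  Companion to the named fact
`NearlyOrdinaryPresentation` (`NearlyOrdinaryPresentation.lean`; G. Böckle, *Presentations of
universal deformation rings*, in: *L-functions and Galois representations*, LMS Lecture Note
Ser. 320, CUP 2007, Theorem 7.6 with Corollary 5.3).  Böckle's theorem ends with a presentation
`R̃ ≅ 𝒪⟦T₁, …, T_ℓ̃⟧/J̃` and the count `ℓ̃ − gen(J̃) ≥ 1 + [F:ℚ]` (for the record's datum); the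
record additionally packages the standard ring-theoretic facts about the presenting ring
`𝒪⟦T₁, …, T_n⟧` that its consumers use.  This file PROVES that last, purely algebraic, layer of
the printed argument (Böckle §2, "`𝒪[[T₁, …, T_h]]` … complete Noetherian local", and the
assembly in the proof of Thm. 7.6), for a complete discrete valuation ring `𝒪` with uniformiser
`ϖ`:

* `mvPowerSeriesFinZeroEquiv`, `mvPowerSeriesFinSuccEquiv` — `R⟦∅⟧ ≃ R` and
  `R⟦X₀, …, X_n⟧ ≃ (R⟦X₀, …, X_{n-1}⟧)⟦T⟧` (bookkeeping for inductions on the number of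
  variables; the second is the tree's `Literature.RingTheory.MvPowerSeries.optionEquivLeft`).
* `isAdicComplete_maximalIdeal_mvPowerSeries` — over a complete local ring `R`,
  `R⟦X₀, …, X_{n-1}⟧` is complete for its maximal ideal.
* `ringKrullDim_add_le_ringKrullDim_mvPowerSeries` — `dim R + n ≤ dim R⟦X₀, …, X_{n-1}⟧`.
* `maximalIdeal_mvPowerSeries_eq` — for `R` local, `𝔪_{R⟦X⟧} = 𝔪_R R⟦X⟧ + (X₀, …, X_{n-1})`;
  `paramList`, `maximalIdeal_eq_ofList_paramList` — over a DVR with uniformiser `ϖ`,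
  `𝔪 = (X₀, …, X_{n-1}, ϖ)` as the ideal of a list.
* `isRegularLocalRing_mvPowerSeries_dvr`, `ringKrullDim_mvPowerSeries_dvr` —
  `𝒪⟦X₀, …, X_{n-1}⟧` is a regular local ring of dimension `n + 1`;
  `isRegular_paramList` — `(X₀, …, X_{n-1}, ϖ)` is a regular sequence (a regular system of
  parameters of a regular local ring, tree `isRegular_of_maximalIdeal_pow_le_ofList`).
* `presentation_of_surjective`, `nearlyOrdinaryPresentation_of_surjective` — **the assembly**:
  for ANY `𝒪`-algebra surjection `𝒪⟦T₁, …, T_n⟧ ↠ R_𝒟` whose kernel `J` satisfies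
  `gen(J) + 1 + [F:ℚ] ≤ n`, the conclusion of `NearlyOrdinaryPresentation` holds for `R_𝒟` (so
  the named fact is reduced to Böckle's inequality `ℓ̃ − gen(J̃) ≥ 1 + [F:ℚ]` for one
  presentation, Thm. 7.6 + Cor. 5.3 proper).
* `NearlyOrdinaryDeformationRing.isLocalHom_algebraMap`, `….exists_sub_algebraMap_mem`,
  `….exists_cotangentPresentation` — Böckle Thm. 2.2 (c) for the interface: `𝒪 → R_𝒟` is local
  with the same residue field, so `R_𝒟` is a quotient of `𝒪⟦T₁, …, T_h⟧` with
  `h = μ(𝔪_{R_𝒟/𝔪_𝒪 R_𝒟})` (`= dim_k t_{R_𝒟}`), by the tree's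
  `Literature.RingTheory.CompleteLocalRings.exists_mvPowerSeries_algHom_surjective_spanFinrank`;
  `nearlyOrdinaryPresentation_of_cotangent_bound` — hence `NearlyOrdinaryPresentation` for `𝓡`
  follows from the single inequality `gen(ker Θ) + 1 + [F:ℚ] ≤ h` for this presentation `Θ`.
* `NearlyOrdinaryDeformationRing.fst_algHom_apply`, `….tangentHomEquiv`,
  `….natCard_algHom_dualNumber` — Böckle Thm. 2.2 (a) for the interface: every `𝒪`-algebra map
  `R_𝒟 → k[ε]` lifts `π` (augmentations are unique), so Mazur's tangent space
  `t_{R_𝒟} = Hom_𝒪(R_𝒟, k[ε])` (in bijection with the deformations of type `𝒟` to `k[ε]` by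
  universality) has `#t_{R_𝒟} = #k ^ h` with the SAME `h` (tree
  `Literature.RingTheory.CompleteLocalRings.RelTangentHom.natCard_eq_pow_spanFinrank`): the
  number of variables of the cotangent presentation is `dim_k t_{R_𝒟}`, as in the printed proof.
* `NearlyOrdinaryDeformationRing.natCard_selmerGroup_eq_pow` — with the tree's
  `NearlyOrdinaryTangentSpace.lean` (`t_{R_𝒟} ≃ H¹_𝒟`, Selmer cocycles modulo coboundaries):
  `#H¹_𝒟 = #k ^ h`, i.e. Böckle's `ℓ̃ = dim_k t_{R̃} = h¹_L` for the record's functor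
  (Thm. 2.2 (a) with Lemma 7.4).  What remains of Theorem 7.6 after this file is exactly the
  relation count `gen(J̃) ≤ h − 1 − [F:ℚ]` (obstruction theory + Poitou–Tate / Greenberg–Wiles +
  local Euler characteristics).

* `NearlyOrdinaryDeformationRing.exists_minimalPresentation`,
  `nearlyOrdinaryPresentation_of_obstruction` — Böckle Thm. 2.2 (d) / Mazur 1989 §1.6 Prop. 2
  for the interface, REDUCED TO ITS DEFORMATION-THEORETIC INPUT: the cotangent presentation can
  be chosen minimal (`ker Θ ⊆ 𝔪² + 𝔪_𝒪 𝒪⟦T⟧`, tree `RelationCount.lean`), and then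
  `NearlyOrdinaryPresentation` for `𝓡` follows from the existence, for the Artinian small
  extension `𝒪⟦T⟧/(𝔪J + 𝔪^n) ↠ R_𝒟/𝔪^n`, of a linear obstruction map into a `k`-vector space
  `O` with `dim_k O + 1 + [F:ℚ] ≤ h` whose vanishing splits the pushed-out extensions (Mazur's
  count `gen(J) ≤ dim_k O`, tree `spanFinrank_le_finrank_of_obstruction`).  In the printed proof
  `O` is assembled from `H²` obstruction classes and `dim_k O` is computed by Poitou–Tate
  duality and the local and global Euler characteristic formulae (not in the tree).

Everything here is proved; no named facts are introduced.

## References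

* G. Böckle, *Presentations of universal deformation rings*, LMS LNS 320 (2007), §2 (p. 27,
  presentations `0 → J → 𝒪[[T₁,…,T_h]] → R → 0`) and Thm. 7.6. [cite: Bockle2007Presentations, §2 and Theorem 7.6]
* B. Mazur, *An introduction to the deformation theory of Galois representations* (1997), §2
  (coefficient `Λ`-algebras: local structure maps, residue field `k`). [cite: Mazur1997Deformation, §2]
* B. Mazur, *Deforming Galois representations*, in Galois groups over `ℚ`, MSRI Publ. 16 (1989),
  §1.6 Prop. 2 (relations bounded by obstructions). [cite: Mazur1989Deforming, §1.6 Prop. 2]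
* H. Matsumura, *Commutative Ring Theory*, CUP 1986, Thm. 3.3 and Ex. 8.6 (power series over a
  complete local ring), Thm. 15.4 (`dim A⟦X⟧ = dim A + 1`), Thm. 17.4 (iii) / 17.8 (a regular
  system of parameters is a regular sequence), Thm. 19.5 (`A` regular ⇒ `A⟦X⟧` regular).
  [cite: Matsumura1987, Thm. 15.4 and Thm. 19.5]
-/

noncomputable section

open IsLocalRing

namespace Literature.NumberTheory.GaloisRepresentations

namespace NearlyOrdinaryPresentationCA

universe u

/-! ## 1. Splitting off variables -/

section Equivs

variable (R : Type u) [CommRing R]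

/-- Power series in no variables are constants: `R⟦X_i : i ∈ Fin 0⟧ ≃+* R` (constant
coefficient, with inverse `C`). [folklore] -/
def mvPowerSeriesFinZeroEquiv : MvPowerSeries (Fin 0) R ≃+* R :=
  RingEquiv.ofRingHom (MvPowerSeries.constantCoeff (σ := Fin 0) (R := R))
    (MvPowerSeries.C (σ := Fin 0) (R := R))
    (by ext r; simp)
    (by
      refine RingHom.ext fun f => ?_
      refine MvPowerSeries.ext fun e => ?_
      obtain rfl : e = 0 := Subsingleton.elim _ _
      simp)

/-- Unfolding lemma for `mvPowerSeriesFinZeroEquiv`. [folklore] -/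
@[simp] theorem mvPowerSeriesFinZeroEquiv_apply (f : MvPowerSeries (Fin 0) R) :
    mvPowerSeriesFinZeroEquiv R f = MvPowerSeries.constantCoeff f := rfl

/-- Unfolding lemma for the inverse of `mvPowerSeriesFinZeroEquiv`. [folklore] -/
@[simp] theorem mvPowerSeriesFinZeroEquiv_symm_apply (r : R) :
    (mvPowerSeriesFinZeroEquiv R).symm r = MvPowerSeries.C r := rfl

/-- Splitting off the variable `X₀`: `R⟦X₀, …, X_n⟧ ≃+* (R⟦X₁, …, X_n⟧)⟦T⟧` (rename along
`Fin (n+1) ≃ Option (Fin n)`, then the tree's `optionEquivLeft`). [folklore] -/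
def mvPowerSeriesFinSuccEquiv (n : ℕ) :
    MvPowerSeries (Fin (n + 1)) R ≃+* PowerSeries (MvPowerSeries (Fin n) R) :=
  (MvPowerSeries.renameEquiv R (finSuccEquiv n)).toRingEquiv.trans
    Literature.RingTheory.MvPowerSeries.optionEquivLeft

end Equivs

/-! ## 2. Completeness and dimension of `R⟦X₁, …, X_n⟧` -/

section Complete

variable (R : Type u) [CommRing R]

/-- **Power series over a complete local ring are complete** for the maximal ideal
(`R` local and `𝔪_R`-adically complete ⇒ `R⟦X₁, …, X_n⟧` is `𝔪`-adically complete), by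
induction on `n` from the one-variable case (tree
`powerSeries_isAdicComplete_maximalIdeal`). [cite: Matsumura1987, Thm. 3.3 and Ex. 8.6] -/
theorem isAdicComplete_maximalIdeal_mvPowerSeries [IsLocalRing R]
    [IsAdicComplete (maximalIdeal R) R] (n : ℕ) :
    IsAdicComplete (maximalIdeal (MvPowerSeries (Fin n) R)) (MvPowerSeries (Fin n) R) := by
  induction n with
  | zero =>
      have h := (IsAdicComplete.congr_ringEquiv (maximalIdeal R)
        (mvPowerSeriesFinZeroEquiv R).symm).mpr ‹_›
      rwa [map_ringEquiv_maximalIdeal] at h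
  | succ n ih =>
      haveI := ih
      haveI := powerSeries_isAdicComplete_maximalIdeal (R := MvPowerSeries (Fin n) R)
      have h := (IsAdicComplete.congr_ringEquiv
        (maximalIdeal (PowerSeries (MvPowerSeries (Fin n) R)))
        (mvPowerSeriesFinSuccEquiv R n).symm).mpr ‹_›
      rwa [map_ringEquiv_maximalIdeal] at h

/-- **`dim R + n ≤ dim R⟦X₁, …, X_n⟧`** (iterate Mathlib's `dim A + 1 ≤ dim A⟦T⟧`).
[cite: Matsumura1987, Thm. 15.4] -/
theorem ringKrullDim_add_le_ringKrullDim_mvPowerSeries (n : ℕ) :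
    ringKrullDim R + n ≤ ringKrullDim (MvPowerSeries (Fin n) R) := by
  induction n with
  | zero =>
      simp [ringKrullDim_eq_of_ringEquiv (mvPowerSeriesFinZeroEquiv R)]
  | succ n ih =>
      simp only [Nat.cast_add, Nat.cast_one, ← add_assoc]
      grw [ih, ringKrullDim_succ_le_ringKrullDim_powerseries]
      exact (ringKrullDim_eq_of_ringEquiv (mvPowerSeriesFinSuccEquiv R n)).ge

end Complete

/-! ## 3. The maximal ideal of `R⟦X₁, …, X_n⟧` -/

section MaximalIdeal

variable (R : Type u) [CommRing R] [IsLocalRing R]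

/-- A power series over a local ring is in the maximal ideal iff its constant coefficient is.
[folklore] -/
theorem mem_maximalIdeal_mvPowerSeries_iff {σ : Type*} (f : MvPowerSeries σ R) :
    f ∈ maximalIdeal (MvPowerSeries σ R) ↔ MvPowerSeries.constantCoeff f ∈ maximalIdeal R := by
  rw [mem_maximalIdeal, mem_maximalIdeal, mem_nonunits_iff, mem_nonunits_iff,
    MvPowerSeries.isUnit_iff_constantCoeff]

/-- **The maximal ideal of `R⟦X₁, …, X_n⟧`** over a local ring `R` is `𝔪_R R⟦X⟧ + (X₁, …, X_n)`
(a series without constant term lies in `(X)`, tree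
`MvPowerSeries.mem_span_range_X_of_constantCoeff_eq_zero`). [cite: Matsumura1987, Thm. 15.4] -/
theorem maximalIdeal_mvPowerSeries_eq (n : ℕ) :
    maximalIdeal (MvPowerSeries (Fin n) R) =
      (maximalIdeal R).map (MvPowerSeries.C (σ := Fin n) (R := R)) ⊔
        Ideal.span (Set.range (MvPowerSeries.X : Fin n → MvPowerSeries (Fin n) R)) := by
  apply le_antisymm
  · intro f hf
    have hc : MvPowerSeries.constantCoeff f ∈ maximalIdeal R :=
      (mem_maximalIdeal_mvPowerSeries_iff R f).mp hf
    have hsplit : f = MvPowerSeries.C (MvPowerSeries.constantCoeff f) +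
        (f - MvPowerSeries.C (MvPowerSeries.constantCoeff f)) := by ring
    rw [hsplit]
    refine Ideal.add_mem _ (Ideal.mem_sup_left (Ideal.mem_map_of_mem _ hc))
      (Ideal.mem_sup_right ?_)
    apply Literature.AlgebraicGeometry.Resolution.MvPowerSeries.mem_span_range_X_of_constantCoeff_eq_zero
    simp
  · refine sup_le ?_ ?_
    · rw [Ideal.map_le_iff_le_comap]
      intro c hc
      rw [Ideal.mem_comap, mem_maximalIdeal_mvPowerSeries_iff, MvPowerSeries.constantCoeff_C]
      exact hc
    · rw [Ideal.span_le]
      rintro _ ⟨i, rfl⟩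
      rw [SetLike.mem_coe, mem_maximalIdeal_mvPowerSeries_iff, MvPowerSeries.constantCoeff_X]
      exact zero_mem _

end MaximalIdeal

/-! ## 4. Power series over a discrete valuation ring -/

section DVR

variable (𝒪 : Type u) [CommRing 𝒪]

/-- The list `(X₀, …, X_{n-1}, ϖ)` of `𝒪⟦X₀, …, X_{n-1}⟧` (for `ϖ` a uniformiser of the DVR `𝒪`
this is a regular system of parameters, `isRegular_paramList`). [folklore] -/
def paramList (ϖ : 𝒪) (n : ℕ) : List (MvPowerSeries (Fin n) 𝒪) :=
  List.ofFn (MvPowerSeries.X : Fin n → MvPowerSeries (Fin n) 𝒪) ++ [MvPowerSeries.C ϖ]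

variable {𝒪}

/-- `paramList ϖ n` has `n + 1` entries. [folklore] -/
@[simp] theorem length_paramList (ϖ : 𝒪) (n : ℕ) : (paramList 𝒪 ϖ n).length = n + 1 := by
  simp [paramList]

/-- The ideal of the list `(X₀, …, X_{n-1}, ϖ)` is `(X) + (ϖ)`. [folklore] -/
theorem ofList_paramList (ϖ : 𝒪) (n : ℕ) :
    Ideal.ofList (paramList 𝒪 ϖ n) =
      Ideal.span (Set.range (MvPowerSeries.X : Fin n → MvPowerSeries (Fin n) 𝒪)) ⊔
        Ideal.span {MvPowerSeries.C ϖ} := by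
  rw [paramList, Ideal.ofList_append, Ideal.ofList_singleton]
  congr 1
  change Ideal.span _ = Ideal.span _
  congr 1
  ext x
  simp only [Set.mem_setOf_eq, List.mem_ofFn, Set.mem_range]

variable [IsDomain 𝒪] [IsDiscreteValuationRing 𝒪]

/-- **`𝔪_{𝒪⟦X⟧} = (X₀, …, X_{n-1}, ϖ)`** for a DVR `𝒪` with uniformiser `ϖ`.
[cite: Matsumura1987, Thm. 15.4] -/
theorem maximalIdeal_eq_ofList_paramList {ϖ : 𝒪} (hϖ : Irreducible ϖ) (n : ℕ) :
    maximalIdeal (MvPowerSeries (Fin n) 𝒪) = Ideal.ofList (paramList 𝒪 ϖ n) := by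
  rw [ofList_paramList, maximalIdeal_mvPowerSeries_eq, hϖ.maximalIdeal_eq, Ideal.map_span,
    Set.image_singleton, sup_comm]

variable (𝒪)

/-- `𝒪⟦X₀, …, X_{n-1}⟧` is Noetherian (tree `isNoetherianRing_mvPowerSeries`, Stacks 0306).
[cite: Matsumura1987, Thm. 3.3] -/
theorem isNoetherianRing_mvPowerSeries_dvr (n : ℕ) : IsNoetherianRing (MvPowerSeries (Fin n) 𝒪) :=
  Literature.AlgebraicGeometry.Resolution.isNoetherianRing_mvPowerSeries 𝒪 (Fin n)

/-- **`𝒪⟦X₀, …, X_{n-1}⟧` is a regular local ring of dimension `n + 1`** for a DVR `𝒪`: its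
maximal ideal needs at most `n + 1` generators while `dim ≥ dim 𝒪 + n = n + 1`.
[cite: Matsumura1987, Thm. 15.4 and Thm. 19.5] -/
theorem isRegularLocalRing_and_ringKrullDim (n : ℕ) :
    IsRegularLocalRing (MvPowerSeries (Fin n) 𝒪) ∧
      ringKrullDim (MvPowerSeries (Fin n) 𝒪) = (n + 1 : ℕ) := by
  classical
  obtain ⟨ϖ, hϖ⟩ := IsDiscreteValuationRing.exists_irreducible 𝒪
  haveI := isNoetherianRing_mvPowerSeries_dvr 𝒪 n
  have hspan : ((maximalIdeal (MvPowerSeries (Fin n) 𝒪)).spanFinrank : WithBot ℕ∞) ≤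
      (n + 1 : ℕ) := by
    rw [maximalIdeal_eq_ofList_paramList hϖ n]
    have hfin : ({x | x ∈ paramList 𝒪 ϖ n} : Set (MvPowerSeries (Fin n) 𝒪)).Finite := by
      rw [← List.coe_toFinset]
      exact (paramList 𝒪 ϖ n).toFinset.finite_toSet
    have h1 := Submodule.spanFinrank_span_le_ncard_of_finite (R := MvPowerSeries (Fin n) 𝒪)
      (M := MvPowerSeries (Fin n) 𝒪) hfin
    have h2 : ({x | x ∈ paramList 𝒪 ϖ n} : Set (MvPowerSeries (Fin n) 𝒪)).ncard ≤ n + 1 := by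
      rw [← List.coe_toFinset, Set.ncard_coe_finset, ← length_paramList ϖ n]
      exact List.toFinset_card_le _
    exact_mod_cast h1.trans h2
  have hdim : ((n + 1 : ℕ) : WithBot ℕ∞) ≤ ringKrullDim (MvPowerSeries (Fin n) 𝒪) := by
    have h := ringKrullDim_add_le_ringKrullDim_mvPowerSeries 𝒪 n
    rw [IsDiscreteValuationRing.ringKrullDim_eq_one] at h
    calc ((n + 1 : ℕ) : WithBot ℕ∞) = 1 + (n : WithBot ℕ∞) := by push_cast; rw [add_comm]
      _ ≤ _ := h
  have hreg : IsRegularLocalRing (MvPowerSeries (Fin n) 𝒪) :=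
    IsRegularLocalRing.of_spanFinrank_maximalIdeal_le _ (hspan.trans hdim)
  refine ⟨hreg, le_antisymm ?_ hdim⟩
  rw [← hreg.spanFinrank_maximalIdeal]
  exact hspan

/-- `𝒪⟦X₀, …, X_{n-1}⟧` is a regular local ring (`𝒪` a DVR). [cite: Matsumura1987, Thm. 19.5] -/
theorem isRegularLocalRing_mvPowerSeries_dvr (n : ℕ) :
    IsRegularLocalRing (MvPowerSeries (Fin n) 𝒪) :=
  (isRegularLocalRing_and_ringKrullDim 𝒪 n).1

/-- **`dim 𝒪⟦X₀, …, X_{n-1}⟧ = n + 1`** (`𝒪` a DVR). [cite: Matsumura1987, Thm. 15.4] -/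
theorem ringKrullDim_mvPowerSeries_dvr (n : ℕ) :
    ringKrullDim (MvPowerSeries (Fin n) 𝒪) = (n + 1 : ℕ) :=
  (isRegularLocalRing_and_ringKrullDim 𝒪 n).2

variable {𝒪}

/-- **`(X₀, …, X_{n-1}, ϖ)` is a regular sequence** on `𝒪⟦X₀, …, X_{n-1}⟧` (a regular system of
parameters of a regular local ring is a regular sequence, tree
`isRegular_of_maximalIdeal_pow_le_ofList`). [cite: Matsumura1987, Thm. 17.4 (iii)] -/
theorem isRegular_paramList {ϖ : 𝒪} (hϖ : Irreducible ϖ) (n : ℕ) :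
    RingTheory.Sequence.IsRegular (MvPowerSeries (Fin n) 𝒪) (paramList 𝒪 ϖ n) := by
  obtain ⟨hreg, hdim⟩ := isRegularLocalRing_and_ringKrullDim 𝒪 n
  refine Literature.RingTheory.RegularLocalRing.isRegular_of_maximalIdeal_pow_le_ofList
    (N := 1) (fun q hq => ?_) ?_ ?_
  · rw [maximalIdeal_eq_ofList_paramList hϖ n]
    exact Ideal.subset_span hq
  · rw [hdim, length_paramList]
  · rw [pow_one, maximalIdeal_eq_ofList_paramList hϖ n]

end DVR

/-! ## 5. The assembly: from a presentation with few relations to the record's conclusion -/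

section Assembly

/-- **Presentations over `𝒪⟦T₁, …, T_n⟧` with a relation count** (the algebraic packaging in
the proof of Böckle's Thm. 7.6): if an `𝒪`-algebra `S` (`𝒪` a complete DVR) receives a
surjection `f : 𝒪⟦T₁, …, T_n⟧ ↠ S` whose kernel `J` has `gen(J) + d ≤ n`, then `S ≅ A/J` with
`A = 𝒪⟦T₁, …, T_n⟧` complete Noetherian local, `𝔪_A = (T₁, …, T_n, ϖ)` generated by a regular
sequence of length `n + 1 = dim A`, and `gen(J) + d ≤ n`.
[cite: Bockle2007Presentations, §2 and Theorem 7.6] -/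
theorem presentation_of_surjective (𝒪 : Type) [CommRing 𝒪] [IsDomain 𝒪]
    [IsDiscreteValuationRing 𝒪] [IsAdicComplete (maximalIdeal 𝒪) 𝒪] {S : Type} [CommRing S]
    [Algebra 𝒪 S] (d : ℕ) {n : ℕ} (f : MvPowerSeries (Fin n) 𝒪 →ₐ[𝒪] S)
    (hf : Function.Surjective f) (hgen : (RingHom.ker f).spanFinrank + d ≤ n) :
    ∃ (A : Type) (_ : CommRing A) (_ : IsNoetherianRing A) (_ : IsLocalRing A)
      (_ : IsAdicComplete (maximalIdeal A) A) (_ : Algebra 𝒪 A) (m : ℕ)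
      (_ : A ≃ₐ[𝒪] MvPowerSeries (Fin m) 𝒪) (rs : List A) (I : Ideal A) (_ : S ≃ₐ[𝒪] A ⧸ I),
      Ideal.ofList rs = maximalIdeal A ∧ RingTheory.Sequence.IsRegular A rs ∧
        rs.length = m + 1 ∧ (rs.length : WithBot ℕ∞) = ringKrullDim A ∧
        I.spanFinrank + d ≤ m := by
  obtain ⟨ϖ, hϖ⟩ := IsDiscreteValuationRing.exists_irreducible 𝒪
  haveI := isNoetherianRing_mvPowerSeries_dvr 𝒪 n
  haveI := isAdicComplete_maximalIdeal_mvPowerSeries 𝒪 n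
  refine ⟨MvPowerSeries (Fin n) 𝒪, inferInstance, inferInstance, inferInstance, inferInstance,
    inferInstance, n, AlgEquiv.refl, paramList 𝒪 ϖ n, RingHom.ker f,
    (Ideal.quotientKerAlgEquivOfSurjective hf).symm,
    (maximalIdeal_eq_ofList_paramList hϖ n).symm, isRegular_paramList hϖ n, length_paramList ϖ n,
    ?_, hgen⟩
  rw [length_paramList, ringKrullDim_mvPowerSeries_dvr]

open scoped NumberField in
/-- **Böckle's Theorem 7.6 ⇒ the record `NearlyOrdinaryPresentation`, ring by ring.**  For a
universal nearly ordinary deformation ring `𝓡` of the interface, ANY `𝒪`-algebra surjection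
`𝒪⟦T₁, …, T_n⟧ ↠ R_𝒟` whose kernel `J̃` satisfies Böckle's count `gen(J̃) + 1 + [F:ℚ] ≤ n`
(Thm. 7.6 with Cor. 5.3, Prop. 7.5, Ex. 6.1(a), 6.3 for the record's datum: `ℓ̃ − gen(J̃) ≥
h⁰(ad) − h⁰(ad^∨) + 3[F:ℚ] − 2[F:ℚ] = 1 + [F:ℚ]`) yields the conclusion of
`NearlyOrdinaryPresentation` for `𝓡` verbatim.  This is the assembly step of the printed proof;
the cohomological count itself (Poitou–Tate / Greenberg–Wiles, local Euler characteristics,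
Mazur's obstruction theory) is what the named fact records. [cite: Bockle2007Presentations, Theorem 7.6 and Corollary 5.3] -/
theorem nearlyOrdinaryPresentation_of_surjective (F : Type) [Field F] [NumberField F] (p : ℕ)
    (𝒪 : Type) [CommRing 𝒪] [IsDomain 𝒪] [IsDiscreteValuationRing 𝒪]
    [IsAdicComplete (maximalIdeal 𝒪) 𝒪] (k : Type) [Field k] [Algebra 𝒪 k]
    (𝒟 : NearlyOrdinaryDatum F p 𝒪 k) (𝓡 : NearlyOrdinaryDeformationRing.{0} 𝒟) {n : ℕ}
    (f : MvPowerSeries (Fin n) 𝒪 →ₐ[𝒪] 𝓡.R) (hf : Function.Surjective f)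
    (hgen : (RingHom.ker f).spanFinrank + 1 + Module.finrank ℚ F ≤ n) :
    ∃ (A : Type) (_ : CommRing A) (_ : IsNoetherianRing A) (_ : IsLocalRing A)
      (_ : IsAdicComplete (maximalIdeal A) A) (_ : Algebra 𝒪 A) (n : ℕ)
      (_ : A ≃ₐ[𝒪] MvPowerSeries (Fin n) 𝒪) (rs : List A) (I : Ideal A) (_ : 𝓡.R ≃ₐ[𝒪] A ⧸ I),
      Ideal.ofList rs = maximalIdeal A ∧ RingTheory.Sequence.IsRegular A rs ∧
        rs.length = n + 1 ∧ (rs.length : WithBot ℕ∞) = ringKrullDim A ∧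
        I.spanFinrank + 1 + Module.finrank ℚ F ≤ n := by
  obtain ⟨A, i1, i2, i3, i4, i5, m, e, rs, I, eR, h1, h2, h3, h4, h5⟩ :=
    presentation_of_surjective 𝒪 (1 + Module.finrank ℚ F) f hf (by omega)
  exact ⟨A, i1, i2, i3, i4, i5, m, e, rs, I, eR, h1, h2, h3, h4, by omega⟩

end Assembly

/-! ## 6. The cotangent presentation of `R_𝒟` (Böckle Thm. 2.2 (c) for the interface) -/

section Cotangent

open scoped NumberField

variable {F : Type} [Field F] [NumberField F] {p : ℕ} {𝒪 : Type} [CommRing 𝒪] [IsLocalRing 𝒪]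
  {k : Type} [Field k] [Algebra 𝒪 k] {𝒟 : NearlyOrdinaryDatum F p 𝒪 k}
  (𝓡 : NearlyOrdinaryDeformationRing.{0} 𝒟)

/-- The kernel of `𝒪 → k` is `𝔪_𝒪` (it is onto the field `k`). [folklore] -/
theorem _root_.Literature.NumberTheory.GaloisRepresentations.NearlyOrdinaryDatum.ker_algebraMap_eq
    (𝒟 : NearlyOrdinaryDatum F p 𝒪 k) :
    RingHom.ker (algebraMap 𝒪 k) = maximalIdeal 𝒪 :=
  IsLocalRing.eq_maximalIdeal (RingHom.ker_isMaximal_of_surjective _ 𝒟.residueMap_surjective)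

/-- **`𝒪 → R_𝒟` is a local homomorphism**: an element of `𝔪_𝒪` maps into
`ker π = 𝔪_{R_𝒟}`. [cite: Mazur1997Deformation, §2] -/
theorem _root_.Literature.NumberTheory.GaloisRepresentations.NearlyOrdinaryDeformationRing.isLocalHom_algebraMap :
    IsLocalHom (algebraMap 𝒪 𝓡.R) := by
  refine ⟨fun o ho => ?_⟩
  by_contra hou
  have hom : o ∈ maximalIdeal 𝒪 := hou
  have h1 : algebraMap 𝒪 𝓡.R o ∈ maximalIdeal 𝓡.R := by
    rw [← 𝓡.ker_π, RingHom.mem_ker, RingHom.coe_coe, AlgHom.commutes]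
    rw [← 𝒟.ker_algebraMap_eq, RingHom.mem_ker] at hom
    exact hom
  exact h1 ho

omit [IsLocalRing 𝒪] in
/-- **`R_𝒟 = 𝒪 + 𝔪_{R_𝒟}`**: the residue fields of `𝒪` and `R_𝒟` agree (both are `k`).
[cite: Mazur1997Deformation, §2] -/
theorem _root_.Literature.NumberTheory.GaloisRepresentations.NearlyOrdinaryDeformationRing.exists_sub_algebraMap_mem
    (c : 𝓡.R) : ∃ l : 𝒪, c - algebraMap 𝒪 𝓡.R l ∈ maximalIdeal 𝓡.R := by
  obtain ⟨l, hl⟩ := 𝒟.residueMap_surjective (𝓡.π c)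
  refine ⟨l, ?_⟩
  rw [← 𝓡.ker_π, RingHom.mem_ker, RingHom.coe_coe, map_sub, AlgHom.commutes, hl, sub_self]

/-- **The cotangent presentation of `R_𝒟`** (Böckle Thm. 2.2 (c): "`R` is a quotient of
`𝒪[[T₁, …, T_h]]`, `h = dim_k t_R`"): for `𝒪` complete local, `R_𝒟` receives a surjective
`𝒪`-algebra map from `𝒪⟦T₁, …, T_h⟧`, `h = μ(𝔪_{R_𝒟/𝔪_𝒪 R_𝒟})` the dimension of the relative
cotangent space `𝔪_R/(𝔪_R² + 𝔪_𝒪 R)` (dual to `t_R = Hom_𝒪(R_𝒟, k[ε])`), the variables mapping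
into `𝔪_{R_𝒟}`. [cite: Bockle2007Presentations, Theorem 2.2] -/
theorem _root_.Literature.NumberTheory.GaloisRepresentations.NearlyOrdinaryDeformationRing.exists_cotangentPresentation
    [IsAdicComplete (maximalIdeal 𝒪) 𝒪] :
    ∃ Θ : MvPowerSeries
        (Fin ((maximalIdeal 𝓡.R).map
          (Ideal.Quotient.mk ((maximalIdeal 𝒪).map (algebraMap 𝒪 𝓡.R)))).spanFinrank) 𝒪 →ₐ[𝒪] 𝓡.R,
      Function.Surjective Θ ∧ ∀ i, Θ (MvPowerSeries.X i) ∈ maximalIdeal 𝓡.R :=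
  haveI := 𝓡.isLocalHom_algebraMap
  Literature.RingTheory.CompleteLocalRings.exists_mvPowerSeries_algHom_surjective_spanFinrank
    𝓡.exists_sub_algebraMap_mem

/-- **`NearlyOrdinaryPresentation` for `𝓡` from Böckle's count for the cotangent presentation.**
With `Θ : 𝒪⟦T₁, …, T_h⟧ ↠ R_𝒟` the cotangent presentation (`h = dim_k t_{R_𝒟}`), the single
inequality `gen(ker Θ) + 1 + [F:ℚ] ≤ h` — Böckle's Theorem 7.6 with Cor. 5.3 for the record's
datum, `ℓ̃ − gen(J̃) ≥ 1 + [F:ℚ]` — yields the record's conclusion for `𝓡`.  (What this file does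
NOT prove is that inequality: it is the obstruction-theoretic relation count
`gen(J̃) ≤ dim` of a dual Selmer group, computed by Poitou–Tate duality and the local and
global Euler characteristic formulae.) [cite: Bockle2007Presentations, Theorem 7.6 and Corollary 5.3] -/
theorem nearlyOrdinaryPresentation_of_cotangent_bound (F : Type) [Field F] [NumberField F]
    (p : ℕ) (𝒪 : Type) [CommRing 𝒪] [IsDomain 𝒪] [IsDiscreteValuationRing 𝒪]
    [IsAdicComplete (maximalIdeal 𝒪) 𝒪] (k : Type) [Field k] [Algebra 𝒪 k]
    (𝒟 : NearlyOrdinaryDatum F p 𝒪 k) (𝓡 : NearlyOrdinaryDeformationRing.{0} 𝒟)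
    (hcount : ∀ Θ : MvPowerSeries
        (Fin ((maximalIdeal 𝓡.R).map
          (Ideal.Quotient.mk ((maximalIdeal 𝒪).map (algebraMap 𝒪 𝓡.R)))).spanFinrank) 𝒪 →ₐ[𝒪] 𝓡.R,
      Function.Surjective Θ →
        (RingHom.ker Θ).spanFinrank + 1 + Module.finrank ℚ F ≤
          ((maximalIdeal 𝓡.R).map
            (Ideal.Quotient.mk ((maximalIdeal 𝒪).map (algebraMap 𝒪 𝓡.R)))).spanFinrank) :
    ∃ (A : Type) (_ : CommRing A) (_ : IsNoetherianRing A) (_ : IsLocalRing A)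
      (_ : IsAdicComplete (maximalIdeal A) A) (_ : Algebra 𝒪 A) (n : ℕ)
      (_ : A ≃ₐ[𝒪] MvPowerSeries (Fin n) 𝒪) (rs : List A) (I : Ideal A) (_ : 𝓡.R ≃ₐ[𝒪] A ⧸ I),
      Ideal.ofList rs = maximalIdeal A ∧ RingTheory.Sequence.IsRegular A rs ∧
        rs.length = n + 1 ∧ (rs.length : WithBot ℕ∞) = ringKrullDim A ∧
        I.spanFinrank + 1 + Module.finrank ℚ F ≤ n := by
  obtain ⟨Θ, hΘ, -⟩ := 𝓡.exists_cotangentPresentation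
  exact nearlyOrdinaryPresentation_of_surjective F p 𝒪 k 𝒟 𝓡 Θ hΘ (hcount Θ hΘ)

end Cotangent

/-! ## 7. `h = dim_k t_{R_𝒟}` (Böckle Thm. 2.2 (a) for the interface) -/

section Tangent

open scoped NumberField
open TrivSqZeroExt DualNumber

variable {F : Type} [Field F] [NumberField F] {p : ℕ} {𝒪 : Type} [CommRing 𝒪]
  {k : Type} [Field k] [Algebra 𝒪 k] {𝒟 : NearlyOrdinaryDatum F p 𝒪 k}
  (𝓡 : NearlyOrdinaryDeformationRing.{0} 𝒟)

/-- **Every `𝒪`-algebra map `R_𝒟 → k[ε]` lifts the augmentation** (`k`-augmentations of local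
`𝒪`-algebras are unique, `NearlyOrdinaryDatum.algHom_residue_unique`).
[cite: Mazur1997Deformation, §15] -/
theorem _root_.Literature.NumberTheory.GaloisRepresentations.NearlyOrdinaryDeformationRing.fst_algHom_apply
    (φ : 𝓡.R →ₐ[𝒪] k[ε]) (r : 𝓡.R) : (φ r).fst = 𝓡.π r := by
  have h := 𝒟.algHom_residue_unique ((TrivSqZeroExt.fstHom 𝒪 k k).comp φ) 𝓡.π
  exact DFunLike.congr_fun h r

/-- **Mazur's tangent space of `R_𝒟` is `Hom_𝒪(R_𝒟, k[ε])`**: the lifting condition is automatic.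
[cite: Mazur1997Deformation, §15] -/
def _root_.Literature.NumberTheory.GaloisRepresentations.NearlyOrdinaryDeformationRing.tangentHomEquiv :
    Literature.RingTheory.CompleteLocalRings.RelTangentHom 𝓡.π ≃ (𝓡.R →ₐ[𝒪] k[ε]) where
  toFun φ := φ.1
  invFun φ := ⟨φ, 𝓡.fst_algHom_apply φ⟩
  left_inv _ := rfl
  right_inv _ := rfl

/-- **`#t_{R_𝒟} = #k ^ h`** with `h = μ(𝔪_{R_𝒟/𝔪_𝒪 R_𝒟})` the number of variables of the
cotangent presentation `exists_cotangentPresentation` (Böckle Thm. 2.2 (a)+(c): "`R` is a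
quotient of `𝒪[[T₁, …, T_h]]`, `h = dim_k t_R`"), for `k` finite and `𝒪` local: the tree's
relative tangent count `RelTangentHom.natCard_eq_pow_spanFinrank` at `(𝒪 → k, R_𝒟, π)`.
[cite: Bockle2007Presentations, Theorem 2.2] [cite: Mazur1997Deformation, §15] -/
theorem _root_.Literature.NumberTheory.GaloisRepresentations.NearlyOrdinaryDeformationRing.natCard_algHom_dualNumber
    [IsLocalRing 𝒪] [Finite k] :
    Nat.card (𝓡.R →ₐ[𝒪] k[ε]) = Nat.card k ^
      ((maximalIdeal 𝓡.R).map
        (Ideal.Quotient.mk ((maximalIdeal 𝒪).map (algebraMap 𝒪 𝓡.R)))).spanFinrank := by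
  rw [← Nat.card_congr 𝓡.tangentHomEquiv,
    Literature.RingTheory.CompleteLocalRings.RelTangentHom.natCard_eq_pow_spanFinrank
      𝒟.residueMap_surjective 𝓡.π,
    Literature.RingTheory.CompleteLocalRings.baseIdeal, 𝒟.ker_algebraMap_eq]

end Tangent

/-! ## 8. `ℓ̃ = h¹_L`: the exponent `h` counts the Selmer group `H¹_𝒟` -/

section Selmer

open scoped NumberField
open DualNumber

variable {F : Type} [Field F] [NumberField F] {p : ℕ} {𝒪 : Type} [CommRing 𝒪] [IsLocalRing 𝒪]
  {k : Type} [Field k] [Algebra 𝒪 k] [Finite k] {𝒟 : NearlyOrdinaryDatum F p 𝒪 k}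
  (𝓡 : NearlyOrdinaryDeformationRing.{0} 𝒟)

/-- **`#H¹_𝒟 = #k ^ h`** (Böckle Thm. 2.2 (a) with Lemma 7.4 for the record's functor: the number
`h` of variables of the cotangent presentation of `R_𝒟` is the `k`-dimension `ℓ̃ = h¹_L` of the
Selmer group of `ad ρ̄` with the unramified conditions outside `S` and Böckle's `L_v` at `v ∣ p`):
`t_{R_𝒟} ≃ H¹_𝒟` (`NearlyOrdinaryDeformationRing.tangentSpaceEquivSelmer`) and `#t_{R_𝒟} = #k ^ h`
(`natCard_algHom_dualNumber`). [cite: Bockle2007Presentations, Theorem 2.2 and Lemma 7.4] -/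
theorem _root_.Literature.NumberTheory.GaloisRepresentations.NearlyOrdinaryDeformationRing.natCard_selmerGroup_eq_pow :
    Nat.card 𝒟.SelmerGroup = Nat.card k ^
      ((maximalIdeal 𝓡.R).map
        (Ideal.Quotient.mk ((maximalIdeal 𝒪).map (algebraMap 𝒪 𝓡.R)))).spanFinrank := by
  rw [𝓡.natCard_selmerGroup, 𝓡.natCard_algHom_dualNumber]

end Selmer

/-! ## 9. Reduction to an obstruction map (Böckle Thm. 2.2 (d); Mazur 1989 §1.6 Prop. 2) -/

section Obstruction

open scoped NumberField

variable {F : Type} [Field F] [NumberField F] {p : ℕ} {𝒪 : Type} [CommRing 𝒪] [IsLocalRing 𝒪]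
  {k : Type} [Field k] [Algebra 𝒪 k] {𝒟 : NearlyOrdinaryDatum F p 𝒪 k}
  (𝓡 : NearlyOrdinaryDeformationRing.{0} 𝒟)

/-- **The minimal cotangent presentation of `R_𝒟`** (Böckle Thm. 2.2 (c)–(d): the variables
`T₁, …, T_h`, `h = dim_k t_R`, map onto a basis of the relative cotangent space, so that the
relation ideal lies in `𝔪² + 𝔪_𝒪 𝒪⟦T⟧`): tree `exists_mvPowerSeries_algHom_surjective_minimal`
at `𝒪 → R_𝒟`. [cite: Bockle2007Presentations, Theorem 2.2] -/
theorem _root_.Literature.NumberTheory.GaloisRepresentations.NearlyOrdinaryDeformationRing.exists_minimalPresentation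
    [IsAdicComplete (maximalIdeal 𝒪) 𝒪] :
    ∃ Θ : MvPowerSeries
        (Fin ((maximalIdeal 𝓡.R).map
          (Ideal.Quotient.mk ((maximalIdeal 𝒪).map (algebraMap 𝒪 𝓡.R)))).spanFinrank) 𝒪 →ₐ[𝒪] 𝓡.R,
      Function.Surjective Θ ∧ (∀ i, Θ (MvPowerSeries.X i) ∈ maximalIdeal 𝓡.R) ∧
        RingHom.ker Θ ≤ maximalIdeal _ ^ 2 ⊔ (maximalIdeal 𝒪).map (algebraMap 𝒪 _) :=
  haveI := 𝓡.isLocalHom_algebraMap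
  Literature.RingTheory.CompleteLocalRings.exists_mvPowerSeries_algHom_surjective_minimal
    𝓡.exists_sub_algebraMap_mem

omit [IsLocalRing 𝒪] in
/-- `𝔪_𝒪 𝒪⟦T⟧ ⊆ 𝔪_{𝒪⟦T⟧}` (constant coefficients). [folklore] -/
theorem map_maximalIdeal_le_mvPowerSeries [IsLocalRing 𝒪] (n : ℕ) :
    (maximalIdeal 𝒪).map (algebraMap 𝒪 (MvPowerSeries (Fin n) 𝒪)) ≤
      maximalIdeal (MvPowerSeries (Fin n) 𝒪) := by
  rw [Ideal.map_le_iff_le_comap]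
  intro a ha
  rw [Ideal.mem_comap, mem_maximalIdeal_mvPowerSeries_iff, MvPowerSeries.algebraMap_apply,
    Algebra.algebraMap_self, RingHom.id_apply, MvPowerSeries.constantCoeff_C]
  exact ha

end Obstruction

section ObstructionCount

open scoped NumberField

variable (F : Type) [Field F] [NumberField F] (p : ℕ) (𝒪 : Type) [CommRing 𝒪] [IsDomain 𝒪]
  [IsDiscreteValuationRing 𝒪] [IsAdicComplete (maximalIdeal 𝒪) 𝒪] (k : Type) [Field k]
  [Algebra 𝒪 k] (𝒟 : NearlyOrdinaryDatum F p 𝒪 k) (𝓡 : NearlyOrdinaryDeformationRing.{0} 𝒟)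

set_option quotPrecheck false in
/-- `h = μ(𝔪_{R_𝒟/𝔪_𝒪 R_𝒟}) = dim_k t_{R_𝒟}`, the number of variables of the cotangent
presentation (local notation). -/
local notation "hR" => ((maximalIdeal (NearlyOrdinaryDeformationRing.R 𝓡)).map
  (Ideal.Quotient.mk ((maximalIdeal 𝒪).map
    (algebraMap 𝒪 (NearlyOrdinaryDeformationRing.R 𝓡))))).spanFinrank

set_option quotPrecheck false in
/-- `𝒪⟦T₁, …, T_h⟧` (local notation). -/
local notation "PR" => MvPowerSeries (Fin hR) 𝒪

/-- **`NearlyOrdinaryPresentation` for `𝓡` from an obstruction map** (Böckle Thm. 2.2 (d) with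
(1) `H²(…)^* ↠ J̃/𝔪J̃`; Mazur 1989 §1.6 Prop. 2 — reduced to its deformation-theoretic input).
Let `Θ : 𝒪⟦T₁, …, T_h⟧ ↠ R_𝒟` range over the MINIMAL cotangent presentations
(`exists_minimalPresentation`) and `n ≥ 2` over the exponents with `J ∩ 𝔪^n ⊆ 𝔪J`, `J = ker Θ`
(Artin–Rees).  Suppose that for each such `(Θ, n)` there is a finite-dimensional `κ`-vector space
`O` (`κ = 𝒪⟦T⟧/𝔪` the residue field) with `dim O + 1 + [F:ℚ] ≤ h` and a `κ`-linear map `ob` on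
the dual of `J/𝔪J` such that `ob u = 0` makes the pushed-out Artinian small extension
`𝒪⟦T⟧/(J_u + 𝔪^n) ↠ 𝒪⟦T⟧/(J + 𝔪^n) = R_𝒟/𝔪^n` split (in the printed proof: `O` = the `H²`
receiving the obstruction classes, its vanishing lifts `ρ_𝒟 mod 𝔪^n`, and universality of `𝓡`
gives the section; `dim O` is then bounded by Poitou–Tate duality and the Euler characteristic
formulae).  Then Mazur's count (tree `spanFinrank_le_finrank_of_obstruction`) gives
`gen(J) ≤ dim O`, hence `gen(J) + 1 + [F:ℚ] ≤ h`, and the record's conclusion follows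
(`nearlyOrdinaryPresentation_of_surjective`).
[cite: Bockle2007Presentations, Theorem 2.2 and Theorem 7.6] [cite: Mazur1989Deforming, §1.6 Prop. 2] -/
theorem nearlyOrdinaryPresentation_of_obstruction
    (hob : ∀ Θ : PR →ₐ[𝒪] 𝓡.R, Function.Surjective Θ →
      RingHom.ker Θ ≤ maximalIdeal PR ^ 2 ⊔ (maximalIdeal 𝒪).map (algebraMap 𝒪 PR) →
      ∀ n : ℕ, 2 ≤ n →
        RingHom.ker Θ ⊓ maximalIdeal PR ^ n ≤ maximalIdeal PR * RingHom.ker Θ →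
      ∃ (O : Type) (_ : AddCommGroup O) (_ : Module (PR ⧸ maximalIdeal PR) O)
        (_ : Module.Finite (PR ⧸ maximalIdeal PR) O)
        (ob : Module.Dual (PR ⧸ maximalIdeal PR)
            (↥(RingHom.ker Θ) ⧸ (maximalIdeal PR • (⊤ : Submodule PR ↥(RingHom.ker Θ)))) →ₗ[PR ⧸
              maximalIdeal PR] O),
        (∀ u, ob u = 0 →
          ∃ s : (PR ⧸ (RingHom.ker Θ ⊔ maximalIdeal PR ^ n)) →ₐ[𝒪]
              (PR ⧸ (Literature.RingTheory.CompleteLocalRings.pushoutIdeal (RingHom.ker Θ) u ⊔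
                maximalIdeal PR ^ n)),
            (Ideal.Quotient.factorₐ 𝒪 (sup_le_sup_right
              (Literature.RingTheory.CompleteLocalRings.pushoutIdeal_le (RingHom.ker Θ) u)
                (maximalIdeal PR ^ n))).comp s = AlgHom.id 𝒪 _) ∧
        Module.finrank (PR ⧸ maximalIdeal PR) O + 1 + Module.finrank ℚ F ≤ hR) :
    ∃ (A : Type) (_ : CommRing A) (_ : IsNoetherianRing A) (_ : IsLocalRing A)
      (_ : IsAdicComplete (maximalIdeal A) A) (_ : Algebra 𝒪 A) (n : ℕ)
      (_ : A ≃ₐ[𝒪] MvPowerSeries (Fin n) 𝒪) (rs : List A) (I : Ideal A) (_ : 𝓡.R ≃ₐ[𝒪] A ⧸ I),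
      Ideal.ofList rs = maximalIdeal A ∧ RingTheory.Sequence.IsRegular A rs ∧
        rs.length = n + 1 ∧ (rs.length : WithBot ℕ∞) = ringKrullDim A ∧
        I.spanFinrank + 1 + Module.finrank ℚ F ≤ n := by
  haveI : IsNoetherianRing PR := isNoetherianRing_mvPowerSeries_dvr 𝒪 _
  obtain ⟨Θ, hΘ, -, hmin⟩ := 𝓡.exists_minimalPresentation
  obtain ⟨n, hn, hJn⟩ :=
    Literature.RingTheory.CompleteLocalRings.exists_inf_pow_le_mul (RingHom.ker Θ)
  obtain ⟨O, _, _, _, ob, hsec, hdim⟩ := hob Θ hΘ hmin n hn hJn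
  have hcount : (RingHom.ker Θ).spanFinrank ≤ Module.finrank (PR ⧸ maximalIdeal PR) O :=
    Literature.RingTheory.CompleteLocalRings.spanFinrank_le_finrank_of_obstruction
      (map_maximalIdeal_le_mvPowerSeries (𝒪 := 𝒪) _) hmin hn hJn ob hsec
  have hle : (RingHom.ker Θ).spanFinrank + 1 + Module.finrank ℚ F ≤ hR :=
    le_trans (Nat.add_le_add_right (Nat.add_le_add_right hcount 1) _) hdim
  exact nearlyOrdinaryPresentation_of_surjective F p 𝒪 k 𝒟 𝓡 Θ hΘ hle

end ObstructionCount


end NearlyOrdinaryPresentationCA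

end Literature.NumberTheory.GaloisRepresentations
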